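import Summits.ValiantsHypothesis.ValiantsHypothesis.Theorems.DefinabilityGapPrivateFree
import HarnessLib

/-!
# Definability gap, ROAD P: blocking is dominated by the independent model (MGF domination)

PLAN (d) v3, item (H1) of NODE-v7 §I / PLAN-N1-v2: the one probabilistic tool the three-round
alteration still needs is an exponential UPPER tail for the number of BLOCKED pivot rows of a
curve — for every curve, hubs included, where the linear count `p · colLoad` is useless.
Abstract setting (product law `prodWeight w` on `ι → Γ`): coordinate `j` taking value `a` HITS
the targets `h j a : Finset R`, AT MOST ONE of them (`#(h j a) ≤ 1` — a curve pivots in one row);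
`blockedBy h S y` = targets hit by some coordinate of `S`; hit probability
`hitProb w h j ρ = Σ_a w j a · [ρ ∈ h j a]`.

MAIN THEOREM `mgf_blocked_le`: for `e ≥ 1`,
`Σ_y prodWeight w y · e^{#blockedBy h S y} ≤ ∏_ρ (e − (e − 1) · ∏_{j ∈ S} (1 − hitProb w h j ρ))`
— the right-hand side is the moment generating function of the model in which the targets are
blocked INDEPENDENTLY with the same marginals; so Chernoff bounds for `#blocked` hold as if the
rows were independent (`weight_manyBlocked_le_mgf` is the Markov read-out).
PROOF: a potential `psi h e S u y = ∏_ρ (if ρ blocked then e else u ρ)` with target weights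
`0 < u ≤ e`; adding one coordinate `j` multiplies it by `1 + Σ_ρ [j hits ρ, ρ not yet blocked]
(e/u ρ − 1)` (`psi_insert`, uses `#(h j a) ≤ 1`); integrating `j` out by the product rule
(`sum_prodWeight_mul_mul_of_dependsOn`) and comparing with `1 + Σ a ≤ ∏ (1 + a)` gives the
one-step domination `bigM (insert j S) u ≤ bigM S u'`, `u' = u + hitProb · (e − u)`
(`bigM_insert_eq`, `bigM_step_le`); induction on `S` yields the closed form (`bigM_le_closed`).
Instantiation (g8): `ι` = curves, `Γ = R = Fin m`, `h c' a = {a}` if `c'` is a co-curve of `c`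
through the column-`s₀` cell of row `a`, else `∅`; then `blockedBy h univ r = blockedRows T c r s₀`.
-/

namespace Summit.ValiantsHypothesis.ValiantsHypothesis.Theorems.DefinabilityGapBlockedMGF

open Finset Literature.Probability.Moments
open Summit.ValiantsHypothesis.ValiantsHypothesis.Theorems.DefinabilityGapBlockIndependence
open Summit.ValiantsHypothesis.ValiantsHypothesis.Theorems.DefinabilityGapPrivateFree

variable {ι Γ R : Type*} [Fintype ι] [DecidableEq ι] [Fintype Γ] [Fintype R] [DecidableEq R]

/-! ## Elementary inequality -/

omit [Fintype R] [DecidableEq R] in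
/-- `1 + Σ a ≤ ∏ (1 + a)` for nonnegative `a`. [lens-5 g7] -/
theorem one_add_sum_le_prod_one_add (s : Finset R) (a : R → ℝ) (ha : ∀ ρ ∈ s, 0 ≤ a ρ) :
    1 + ∑ ρ ∈ s, a ρ ≤ ∏ ρ ∈ s, (1 + a ρ) := by
  classical
  induction s using Finset.induction_on with
  | empty => simp
  | @insert k s hk ih =>
      have hk0 : 0 ≤ a k := ha k (mem_insert_self k s)
      have hs : ∀ ρ ∈ s, 0 ≤ a ρ := fun ρ hρ => ha ρ (mem_insert_of_mem hρ)
      have hsum : 0 ≤ ∑ ρ ∈ s, a ρ := sum_nonneg hs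
      rw [sum_insert hk, prod_insert hk]
      calc 1 + (a k + ∑ ρ ∈ s, a ρ) ≤ (1 + a k) * (1 + ∑ ρ ∈ s, a ρ) := by
            nlinarith [mul_nonneg hk0 hsum]
        _ ≤ (1 + a k) * ∏ ρ ∈ s, (1 + a ρ) :=
            mul_le_mul_of_nonneg_left (ih hs) (by linarith)

/-! ## Blocked targets, hit probabilities, the potential -/

/-- The targets blocked under `y` by the coordinates in `S`. [lens-5 g7] -/
def blockedBy (h : ι → Γ → Finset R) (S : Finset ι) (y : ι → Γ) : Finset R :=
  univ.filter fun ρ => ∃ j ∈ S, ρ ∈ h j (y j)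

omit [Fintype ι] [DecidableEq ι] [Fintype Γ] in
/-- Membership in `blockedBy`. [lens-5 g7] -/
theorem mem_blockedBy (h : ι → Γ → Finset R) (S : Finset ι) (y : ι → Γ) (ρ : R) :
    ρ ∈ blockedBy h S y ↔ ∃ j ∈ S, ρ ∈ h j (y j) := by
  simp [blockedBy]

omit [Fintype ι] [DecidableEq ι] [Fintype Γ] in
/-- No coordinates block nothing. [lens-5 g7] -/
theorem blockedBy_empty (h : ι → Γ → Finset R) (y : ι → Γ) : blockedBy h ∅ y = ∅ := by
  ext ρ; simp [mem_blockedBy]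

omit [Fintype ι] [Fintype Γ] in
/-- One more coordinate blocks what it hits. [lens-5 g7] -/
theorem mem_blockedBy_insert (h : ι → Γ → Finset R) (S : Finset ι) (j : ι) (y : ι → Γ)
    (ρ : R) : ρ ∈ blockedBy h (insert j S) y ↔ ρ ∈ h j (y j) ∨ ρ ∈ blockedBy h S y := by
  simp [mem_blockedBy]

omit [Fintype ι] [DecidableEq ι] [Fintype Γ] in
/-- `blockedBy h S` depends only on the coordinates in `S`. [lens-5 g7] -/
theorem blockedBy_dependsOn (h : ι → Γ → Finset R) (S : Finset ι) :
    DependsOn (fun y => blockedBy h S y) (↑S : Set ι) := by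
  intro x y hxy
  ext ρ
  simp only [mem_blockedBy]
  exact exists_congr fun j => and_congr_right fun hj => by rw [hxy j (mem_coe.mpr hj)]

/-- Hit probability of target `ρ` by coordinate `j`: `Σ_a w j a · [ρ ∈ h j a]`. [lens-5 g7] -/
noncomputable def hitProb (w : ι → Γ → ℝ) (h : ι → Γ → Finset R) (j : ι) (ρ : R) : ℝ :=
  ∑ a, w j a * if ρ ∈ h j a then 1 else 0

omit [Fintype ι] [DecidableEq ι] [Fintype R] in
/-- Hit probabilities are nonnegative. [lens-5 g7] -/
theorem hitProb_nonneg {w : ι → Γ → ℝ} (hw : ∀ i a, 0 ≤ w i a) (h : ι → Γ → Finset R) (j : ι)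
    (ρ : R) : 0 ≤ hitProb w h j ρ :=
  sum_nonneg fun a _ => mul_nonneg (hw j a) (by split_ifs <;> norm_num)

omit [Fintype ι] [DecidableEq ι] [Fintype R] in
/-- Hit probabilities are at most one. [lens-5 g7] -/
theorem hitProb_le_one {w : ι → Γ → ℝ} (hw : ∀ i a, 0 ≤ w i a) (hw1 : ∀ i, ∑ a, w i a = 1)
    (h : ι → Γ → Finset R) (j : ι) (ρ : R) : hitProb w h j ρ ≤ 1 := by
  calc hitProb w h j ρ ≤ ∑ a, w j a :=
        sum_le_sum fun a _ => by split_ifs <;> nlinarith [hw j a]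
    _ = 1 := hw1 j

/-- The potential: blocked targets weigh `e`, unblocked ones `u ρ`. [lens-5 g7] -/
noncomputable def psi (h : ι → Γ → Finset R) (e : ℝ) (S : Finset ι) (u : R → ℝ)
    (y : ι → Γ) : ℝ :=
  ∏ ρ, if ρ ∈ blockedBy h S y then e else u ρ

/-- Its expectation under the product law. [lens-5 g7] -/
noncomputable def bigM (w : ι → Γ → ℝ) (h : ι → Γ → Finset R) (e : ℝ) (S : Finset ι)
    (u : R → ℝ) : ℝ :=
  ∑ y, prodWeight w y * psi h e S u y

omit [Fintype ι] [DecidableEq ι] [Fintype Γ] in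
/-- The potential is nonnegative for `0 ≤ u ≤ e`. [lens-5 g7] -/
theorem psi_nonneg (h : ι → Γ → Finset R) {e : ℝ} (S : Finset ι) {u : R → ℝ}
    (hu0 : ∀ ρ, 0 ≤ u ρ) (hue : ∀ ρ, u ρ ≤ e) (y : ι → Γ) : 0 ≤ psi h e S u y :=
  prod_nonneg fun ρ _ => by
    split_ifs
    · exact (hu0 ρ).trans (hue ρ)
    · exact hu0 ρ

omit [Fintype ι] [DecidableEq ι] [Fintype Γ] in
/-- Blocking one more target `ρ₀ ∉ D` trades the factor `v ρ₀` for `e`. [lens-5 g7] -/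
theorem prod_ite_insert_mul (D : Finset R) (ρ₀ : R) (hρ₀ : ρ₀ ∉ D) (e : ℝ) (v : R → ℝ) :
    (∏ ρ, if ρ ∈ insert ρ₀ D then e else v ρ) * v ρ₀ =
      (∏ ρ, if ρ ∈ D then e else v ρ) * e := by
  have h1 : ∏ ρ, (if ρ ∈ insert ρ₀ D then e else v ρ) =
      e * ∏ ρ ∈ univ.erase ρ₀, (if ρ ∈ D then e else v ρ) := by
    rw [← Finset.mul_prod_erase univ _ (mem_univ ρ₀)]
    congr 1
    · simp
    · refine prod_congr rfl fun ρ hρ => ?_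
      have hne : ρ ≠ ρ₀ := ne_of_mem_erase hρ
      simp only [mem_insert, hne, false_or]
  have h2 : ∏ ρ, (if ρ ∈ D then e else v ρ) =
      v ρ₀ * ∏ ρ ∈ univ.erase ρ₀, (if ρ ∈ D then e else v ρ) := by
    rw [← Finset.mul_prod_erase univ _ (mem_univ ρ₀)]
    congr 1
    simp [hρ₀]
  rw [h1, h2]; ring

/-! ## One more coordinate -/

omit [Fintype ι] [Fintype Γ] in
/-- Adding coordinate `j` multiplies the potential by
`1 + Σ_ρ [j hits ρ, ρ not yet blocked] (e / u ρ − 1)` (a coordinate hits ≤ 1 target). [lens-5 g7] -/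
theorem psi_insert (h : ι → Γ → Finset R) (hh : ∀ j a, #(h j a) ≤ 1) (e : ℝ) (S : Finset ι)
    (j : ι) {u : R → ℝ} (hu : ∀ ρ, u ρ ≠ 0) (y : ι → Γ) :
    psi h e (insert j S) u y = psi h e S u y *
      (1 + ∑ ρ, if ρ ∈ h j (y j) ∧ ρ ∉ blockedBy h S y then e / u ρ - 1 else 0) := by
  unfold psi
  rcases (h j (y j)).eq_empty_or_nonempty with h0 | ⟨ρ₀, hρ₀⟩
  · have hB : blockedBy h (insert j S) y = blockedBy h S y := by
      ext ρ; simp [mem_blockedBy_insert, h0]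
    simp [hB, h0]
  · have hsing : h j (y j) = {ρ₀} :=
      Finset.eq_singleton_iff_unique_mem.mpr
        ⟨hρ₀, fun ρ hρ => Finset.card_le_one.mp (hh j (y j)) ρ hρ ρ₀ hρ₀⟩
    by_cases hb : ρ₀ ∈ blockedBy h S y
    · have hB : blockedBy h (insert j S) y = blockedBy h S y := by
        ext ρ
        rw [mem_blockedBy_insert, hsing, mem_singleton]
        constructor
        · rintro (rfl | hρ)
          · exact hb
          · exact hρ
        · exact fun hρ => Or.inr hρ
      have hsum : ∑ ρ, (if ρ ∈ h j (y j) ∧ ρ ∉ blockedBy h S y then e / u ρ - 1 else 0)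
          = 0 := by
        refine sum_eq_zero fun ρ _ => ?_
        split_ifs with hc
        · obtain ⟨h1, h2⟩ := hc
          rw [hsing, mem_singleton] at h1
          subst h1
          exact absurd hb h2
        · rfl
      rw [hB, hsum]; ring
    · have hB : blockedBy h (insert j S) y = insert ρ₀ (blockedBy h S y) := by
        ext ρ; rw [mem_blockedBy_insert, hsing, mem_singleton, mem_insert]
      have hsum : ∑ ρ, (if ρ ∈ h j (y j) ∧ ρ ∉ blockedBy h S y then e / u ρ - 1 else 0)
          = e / u ρ₀ - 1 := by
        rw [Finset.sum_eq_single ρ₀]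
        · rw [if_pos ⟨hρ₀, hb⟩]
        · intro ρ _ hne
          rw [if_neg]
          rintro ⟨h1, _⟩
          rw [hsing, mem_singleton] at h1
          exact hne h1
        · exact fun hρ => absurd (mem_univ ρ₀) hρ
      rw [hB, hsum]
      have key := prod_ite_insert_mul (blockedBy h S y) ρ₀ hb e u
      have : (∏ ρ, if ρ ∈ insert ρ₀ (blockedBy h S y) then e else u ρ) =
          (∏ ρ, if ρ ∈ blockedBy h S y then e else u ρ) * e / u ρ₀ := by
        rw [eq_div_iff (hu ρ₀)]; exact key
      rw [this]; ring

/-- **Integration of one coordinate** (`j ∉ S`): by the product rule,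
`M_{S∪j}(u) = M_S(u) + Σ_ρ E[Ψ_S(u)·[ρ unblocked]·(e/u ρ − 1)] · hitProb j ρ`. [lens-5 g7] -/
theorem bigM_insert_eq {w : ι → Γ → ℝ} (hw1 : ∀ i, ∑ a, w i a = 1) (h : ι → Γ → Finset R)
    (hh : ∀ j a, #(h j a) ≤ 1) (e : ℝ) {S : Finset ι} {j : ι} (hj : j ∉ S) {u : R → ℝ}
    (hu : ∀ ρ, u ρ ≠ 0) :
    bigM w h e (insert j S) u = bigM w h e S u +
      ∑ ρ, (∑ y, prodWeight w y *
        (psi h e S u y * if ρ ∉ blockedBy h S y then e / u ρ - 1 else 0)) *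
          hitProb w h j ρ := by
  unfold bigM
  have hsplit : ∀ y, prodWeight w y * psi h e (insert j S) u y =
      prodWeight w y * psi h e S u y + ∑ ρ, prodWeight w y *
        ((psi h e S u y * if ρ ∉ blockedBy h S y then e / u ρ - 1 else 0) *
          (if ρ ∈ h j (y j) then (1 : ℝ) else 0)) := by
    intro y
    have hpt : ∀ ρ, (if ρ ∈ h j (y j) ∧ ρ ∉ blockedBy h S y then e / u ρ - 1 else (0 : ℝ)) =
        (if ρ ∉ blockedBy h S y then e / u ρ - 1 else 0) *
          (if ρ ∈ h j (y j) then (1 : ℝ) else 0) := by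
      intro ρ
      by_cases H : ρ ∈ h j (y j) <;> simp [H]
    rw [psi_insert h hh e S j hu y]
    simp_rw [hpt]
    rw [mul_add, mul_one, mul_sum, mul_add, mul_sum]
    congr 1
    refine sum_congr rfl fun ρ _ => ?_
    ring
  simp_rw [hsplit]
  rw [sum_add_distrib, sum_comm]
  congr 1
  refine sum_congr rfl fun ρ _ => ?_
  have hF : DependsOn (fun y => psi h e S u y *
      if ρ ∉ blockedBy h S y then e / u ρ - 1 else 0) (↑S : Set ι) := by
    intro x z hxz
    have hB : blockedBy h S x = blockedBy h S z := blockedBy_dependsOn h S hxz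
    simp only [psi, hB]
  have hG : DependsOn (fun y : ι → Γ => if ρ ∈ h j (y j) then (1 : ℝ) else 0)
      ((↑S : Set ι)ᶜ) := by
    intro x z hxz
    have hjS : j ∈ ((↑S : Set ι)ᶜ) := by simpa using hj
    simp only [hxz j hjS]
  rw [sum_prodWeight_mul_mul_of_dependsOn hw1 S hF hG]
  congr 1
  rw [sum_prodWeight_mul_coord hw1 j (fun a => if ρ ∈ h j a then (1 : ℝ) else 0)]
  rfl

/-- **Domination step**: the integrated potential is at most the potential with the updated
weights `u' = u + hitProb · (e − u)` — the independent model — by `1 + Σ a ≤ ∏ (1 + a)`.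
[lens-5 g7] -/
theorem bigM_step_le {w : ι → Γ → ℝ} (hw : ∀ i a, 0 ≤ w i a) (h : ι → Γ → Finset R)
    (e : ℝ) (S : Finset ι) (j : ι) {u : R → ℝ} (hu0 : ∀ ρ, 0 < u ρ) (hue : ∀ ρ, u ρ ≤ e) :
    bigM w h e S u + ∑ ρ, (∑ y, prodWeight w y *
        (psi h e S u y * if ρ ∉ blockedBy h S y then e / u ρ - 1 else 0)) * hitProb w h j ρ
      ≤ bigM w h e S (fun ρ => u ρ + hitProb w h j ρ * (e - u ρ)) := by
  unfold bigM
  have hre : (∑ ρ, (∑ y, prodWeight w y *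
      (psi h e S u y * if ρ ∉ blockedBy h S y then e / u ρ - 1 else 0)) * hitProb w h j ρ) =
      ∑ y, ∑ ρ, prodWeight w y *
        (psi h e S u y * if ρ ∉ blockedBy h S y then e / u ρ - 1 else 0) * hitProb w h j ρ := by
    simp_rw [Finset.sum_mul]
    exact Finset.sum_comm
  rw [hre, ← sum_add_distrib]
  refine sum_le_sum fun y _ => ?_
  set a : R → ℝ := fun ρ =>
    hitProb w h j ρ * (if ρ ∉ blockedBy h S y then e / u ρ - 1 else 0) with ha_def
  have ha : ∀ ρ, 0 ≤ a ρ := by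
    intro ρ
    simp only [ha_def]
    refine mul_nonneg (hitProb_nonneg hw h j ρ) ?_
    have : 1 ≤ e / u ρ := (one_le_div (hu0 ρ)).mpr (hue ρ)
    split_ifs <;> linarith
  have hpsi' : psi h e S (fun ρ => u ρ + hitProb w h j ρ * (e - u ρ)) y =
      psi h e S u y * ∏ ρ, (1 + a ρ) := by
    unfold psi
    rw [← prod_mul_distrib]
    refine prod_congr rfl fun ρ _ => ?_
    simp only [ha_def]
    have := (hu0 ρ).ne'
    split_ifs with hb
    · ring
    · field_simp
  have hnn : 0 ≤ prodWeight w y * psi h e S u y :=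
    mul_nonneg (prodWeight_nonneg hw y) (psi_nonneg h S (fun ρ => (hu0 ρ).le) hue y)
  calc prodWeight w y * psi h e S u y + ∑ ρ, prodWeight w y *
        (psi h e S u y * if ρ ∉ blockedBy h S y then e / u ρ - 1 else 0) * hitProb w h j ρ
        = prodWeight w y * psi h e S u y * (1 + ∑ ρ, a ρ) := by
          rw [mul_add, mul_one, mul_sum]
          congr 1
          refine sum_congr rfl fun ρ _ => ?_
          simp only [ha_def]; ring
    _ ≤ prodWeight w y * psi h e S u y * ∏ ρ, (1 + a ρ) :=
          mul_le_mul_of_nonneg_left (one_add_sum_le_prod_one_add univ a fun ρ _ => ha ρ) hnn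
    _ = prodWeight w y * psi h e S (fun ρ => u ρ + hitProb w h j ρ * (e - u ρ)) y := by
          rw [hpsi', mul_assoc]

/-! ## The closed form and the MGF bound -/

/-- **MGF domination, closed form**: for target weights `0 < u ≤ e`,
`M_S(u) ≤ ∏_ρ (e − (e − u ρ) ∏_{j∈S} (1 − hitProb j ρ))`. [lens-5 g7] -/
theorem bigM_le_closed {w : ι → Γ → ℝ} (hw : ∀ i a, 0 ≤ w i a) (hw1 : ∀ i, ∑ a, w i a = 1)
    (h : ι → Γ → Finset R) (hh : ∀ j a, #(h j a) ≤ 1) (e : ℝ) (S : Finset ι) :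
    ∀ u : R → ℝ, (∀ ρ, 0 < u ρ) → (∀ ρ, u ρ ≤ e) →
      bigM w h e S u ≤ ∏ ρ, (e - (e - u ρ) * ∏ j ∈ S, (1 - hitProb w h j ρ)) := by
  induction S using Finset.induction_on with
  | empty =>
      intro u _ _
      simp only [bigM, psi, blockedBy_empty, Finset.notMem_empty, if_false, prod_empty, mul_one,
        sub_sub_cancel]
      rw [← sum_mul, sum_prodWeight hw1, one_mul]
  | @insert j S hj ih =>
      intro u hu0 hue
      have hu : ∀ ρ, u ρ ≠ 0 := fun ρ => (hu0 ρ).ne'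
      have hW0 : ∀ ρ, 0 ≤ hitProb w h j ρ := fun ρ => hitProb_nonneg hw h j ρ
      have hW1 : ∀ ρ, hitProb w h j ρ ≤ 1 := fun ρ => hitProb_le_one hw hw1 h j ρ
      have hu'0 : ∀ ρ, 0 < u ρ + hitProb w h j ρ * (e - u ρ) := fun ρ => by
        nlinarith [hu0 ρ, hue ρ, hW0 ρ, mul_nonneg (hW0 ρ) (sub_nonneg.mpr (hue ρ))]
      have hu'e : ∀ ρ, u ρ + hitProb w h j ρ * (e - u ρ) ≤ e := fun ρ => by
        nlinarith [hue ρ, hW1 ρ, mul_nonneg (sub_nonneg.mpr (hW1 ρ)) (sub_nonneg.mpr (hue ρ))]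
      calc bigM w h e (insert j S) u
          = bigM w h e S u + ∑ ρ, (∑ y, prodWeight w y *
              (psi h e S u y * if ρ ∉ blockedBy h S y then e / u ρ - 1 else 0)) *
                hitProb w h j ρ := bigM_insert_eq hw1 h hh e hj hu
        _ ≤ bigM w h e S (fun ρ => u ρ + hitProb w h j ρ * (e - u ρ)) :=
            bigM_step_le hw h e S j hu0 hue
        _ ≤ ∏ ρ, (e - (e - (u ρ + hitProb w h j ρ * (e - u ρ))) *
              ∏ k ∈ S, (1 - hitProb w h k ρ)) := ih _ hu'0 hu'e
        _ = ∏ ρ, (e - (e - u ρ) * ∏ k ∈ insert j S, (1 - hitProb w h k ρ)) := by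
            refine prod_congr rfl fun ρ _ => ?_
            rw [prod_insert hj]; ring

/-- **MGF DOMINATION**: for `e ≥ 1`,
`E[e^{#blocked}] ≤ ∏_ρ (e − (e − 1) ∏_{j∈S} (1 − hitProb j ρ))`, the MGF of independently
blocked targets with the same marginals. [lens-5 g7] -/
theorem mgf_blocked_le {w : ι → Γ → ℝ} (hw : ∀ i a, 0 ≤ w i a) (hw1 : ∀ i, ∑ a, w i a = 1)
    (h : ι → Γ → Finset R) (hh : ∀ j a, #(h j a) ≤ 1) {e : ℝ} (he : 1 ≤ e) (S : Finset ι) :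
    ∑ y, prodWeight w y * e ^ #(blockedBy h S y) ≤
      ∏ ρ, (e - (e - 1) * ∏ j ∈ S, (1 - hitProb w h j ρ)) := by
  have hpsi : ∀ y, psi h e S (fun _ => 1) y = e ^ #(blockedBy h S y) := fun y => by
    unfold psi
    rw [Finset.prod_ite_mem, univ_inter, prod_const]
  have hmain := bigM_le_closed hw hw1 h hh e S (fun _ => 1) (fun _ => one_pos) (fun _ => he)
  unfold bigM at hmain
  simp_rw [hpsi] at hmain
  exact hmain

/-- The same with `e = exp θ`, `θ ≥ 0`. [lens-5 g7] -/
theorem mgf_blocked_exp_le {w : ι → Γ → ℝ} (hw : ∀ i a, 0 ≤ w i a) (hw1 : ∀ i, ∑ a, w i a = 1)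
    (h : ι → Γ → Finset R) (hh : ∀ j a, #(h j a) ≤ 1) {θ : ℝ} (hθ : 0 ≤ θ) (S : Finset ι) :
    ∑ y, prodWeight w y * Real.exp (θ * #(blockedBy h S y)) ≤
      ∏ ρ, (Real.exp θ - (Real.exp θ - 1) * ∏ j ∈ S, (1 - hitProb w h j ρ)) := by
  have he : 1 ≤ Real.exp θ := Real.one_le_exp hθ
  have hpow : ∀ y, Real.exp (θ * #(blockedBy h S y)) = Real.exp θ ^ #(blockedBy h S y) :=
    fun y => by rw [mul_comm, Real.exp_nat_mul]
  simp_rw [hpow]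
  exact mgf_blocked_le hw hw1 h hh he S

/-- **Markov read-out**: `W{t ≤ #blocked} ≤ e^{−t} · ∏_ρ (e − (e − 1) ∏_{j∈S} (1 − hitProb j ρ))`
for `e ≥ 1`. [lens-5 g7] -/
theorem weight_manyBlocked_le_mgf {w : ι → Γ → ℝ} (hw : ∀ i a, 0 ≤ w i a)
    (hw1 : ∀ i, ∑ a, w i a = 1) (h : ι → Γ → Finset R) (hh : ∀ j a, #(h j a) ≤ 1) {e : ℝ}
    (he : 1 ≤ e) (S : Finset ι) (t : ℕ) :
    ∑ y ∈ univ.filter (fun y => t ≤ #(blockedBy h S y)), prodWeight w y ≤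
      (∏ ρ, (e - (e - 1) * ∏ j ∈ S, (1 - hitProb w h j ρ))) / e ^ t := by
  have he0 : 0 < e := one_pos.trans_le he
  have het : 0 < e ^ t := pow_pos he0 t
  rw [le_div_iff₀ het]
  calc (∑ y ∈ univ.filter (fun y => t ≤ #(blockedBy h S y)), prodWeight w y) * e ^ t
      = ∑ y ∈ univ.filter (fun y => t ≤ #(blockedBy h S y)), prodWeight w y * e ^ t := by
        rw [sum_mul]
    _ ≤ ∑ y ∈ univ.filter (fun y => t ≤ #(blockedBy h S y)),
          prodWeight w y * e ^ #(blockedBy h S y) := by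
        refine sum_le_sum fun y hy => ?_
        have ht : t ≤ #(blockedBy h S y) := (mem_filter.mp hy).2
        exact mul_le_mul_of_nonneg_left (pow_le_pow_right₀ he ht) (prodWeight_nonneg hw y)
    _ ≤ ∑ y, prodWeight w y * e ^ #(blockedBy h S y) :=
        sum_le_univ_sum_of_nonneg fun y =>
          mul_nonneg (prodWeight_nonneg hw y) (pow_nonneg he0.le _)
    _ ≤ ∏ ρ, (e - (e - 1) * ∏ j ∈ S, (1 - hitProb w h j ρ)) := mgf_blocked_le hw hw1 h hh he S

end Summit.ValiantsHypothesis.ValiantsHypothesis.Theorems.DefinabilityGapBlockedMGF
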